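import Literature.MathematicalPhysics.QuantumFieldTheory.Balaban1983to89.B8Thm32GBoundDentedCubeMember

/-!
# `Balaban1983to89.B8Real123DentedCubeMember` — [Balaban1985RegularSpaces] (1.91)–(1.92), (1.98), (1.101) (= [Balaban1985BackgroundPropagators] THEOREMS 3.1–3.2 AT
# `U = 1`) ON THE DENTED CUBE MEMBER `{Ω′_j}` OF [Balaban1985Variational] (148)–(150), TOP TRUNCATION — THE THREE REAL INEQUALITY FAMILIES OF THE p6 FLAT CONSUMER, NAMED

statement-level skeleton of published theorems with citation tags; proofs where landed; nothing here is a claim about the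
Yang–Mills mass gap

`[Balaban1985RegularSpaces]` ("B8" = [6], CMP **99** (1985) 75–102) (1.91)–(1.92) p. 91 («from Theorems 3.1, 3.2 of [4] it follows …»: the propagator `T⁻¹ = (Δ^η + Q*aQ)⁻¹`
of the flat multi-level operator and its gradient, weighted sup bounds), (1.98) p. 92 (the projection `1 − T⁻¹Qᵀ(QT⁻²Qᵀ)⁻¹QT⁻¹`), (1.101) p. 93 (the operator `T⁻¹T⁻¹Qᵀ(QT⁻²Qᵀ)⁻¹`
and its gradient ∕ Laplacian), p. 98 (the cubes' sub-lattice «M is a multiple of R₁M₁»); `[Balaban1985BackgroundPropagators]` ("[4]", CMP **99** (1985) 389–434) Theorem 3.1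
(3.47) p. 398, Theorem 3.2 (3.48) p. 398 («Under the assumptions of Theorem 3.1, and with the same constants …»); `[Balaban1985Variational]` ("[15]", CMP **102** (1985)
277–309) p. 300 («a cube □ intersecting Ω_j but not Ω_{j+1}»), (148)–(150) p. 301 («Ω′_j = □_j, j = 0, 1, …, k − 1»; «… defined … for the sequence {Ω′_j} instead of {Ω_j}»);
`[Balaban1984PropagatorsII]` ("B6") Prop. 2.3 (2.87) p. 238.  PDF held: `paper:balaban1985-cmp99-regular-spaces-gauge-fixing`, `paper:balaban1985-cmp102-variational-background`.

CITATION HEADER (lean-in-tree rule).  Cell `pub-ymgap` (YM Track A, HUMAN RULING D-0062), DAG node N05 = [B8], seat `pub-ymgap-dag-n05-e` (g31; FAN-OUT §N05 row s3b,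
Proposition-6 lane; the (β) road — NODE 00 datum (d1) p655171 `Node00.CubeB8D ∕ GaugedBoundB8D`, (d2-a) p659647 ∕ p659892, (d2-a)-C p661669, (d3) p661581 … p665103).
WHY THIS FILE.  The pure crown `B8Prop6CubeMemberScalarGammaPrinted.gaugedBoundB8_cubeMember_scalar_γ_printed` feeds the flat p6 letter's THREE REAL inequality
families at every truncation `1 ≤ n ≤ k` of a pure cube member from dag-n05-c's UNCONDITIONAL `B8Thm32GBoundCubeMemberHolds.prop6_real123_printed` (REAL-1 = (1.91)–(1.92)
for `T⁻¹` by the parametrix files `B8Eq1101CubeMember*`, REAL-2 = (1.101) from REAL-1 and the 𝒢-bound ([4] Thm 3.2, `GBoundCubeMemberPrinted`, PROVED), REAL-3 = (1.98)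
by algebra).  On the DENTED member `c : Node00.CubeB8D` ([15] (148)–(150): `Ω′_j = □_j (j < k)`, `Ω′_k = □_k ∩ Ω_k`) the truncations `n < k` ARE the pure member's
(`CubeB8D.sq_of_lt`, `B8DentedCubeMemberZd.lamST_of_lt`), so the pure theorem serves them verbatim; the TOP truncation `n = k` lives on the dented site tower `c.sq` and
the dented cells `c.lamS`, where the parametrix files (≈ 2.7 kLoC keyed on `cubeDomains ∕ cubeLamS`) have no twin yet.  THIS FILE names that top-truncation triple:
`Real123DentedCubeMemberPrinted d ℓ` = the body of `prop6_real123_printed d ℓ` VERBATIM at `n = k` under the letter map `cubeFam false … j ↦ c.sq j`,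
`cubeLamS … k j ↦ c.lamS j`, `(a, M, ρ, k) ↦ c`'s fields, with the sub-lattice side conditions verbatim PLUS the one premise the dent costs (the same as in
`GBoundDentedCubeMemberPrinted`, p661669): «`Ω_k` is a union of cubes of side `M_hL^{k+1}` of the grid anchored at `□_k`'s fine lower corner `Lᵏ(c.a − c.ρ)`» ([6] (1.4)₂).
It is the third (and last) dented named input of the (β) crown `B8Prop6DentedCubeMemberScalarGammaOfNamedFacts` (this seat, next file), beside
`Ineq159FlatDentedCubeMemberPrinted` (p659892) and — through the future reduction REAL ← REAL-1 + 𝒢-bound (dented twins of `B8Eq192CubeMemberOfReal1G` ∕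
`B8Eq198CubeMemberOfReal12`) — `GBoundDentedCubeMemberPrinted` (p661669).

WHAT THIS FILE DECLARES.  `Real123DentedCubeMemberPrinted (d ℓ : ℕ) : Prop` — a `def`, NOT an axiom, NOT proved here (OPEN in the tree; print proves (1.91)–(1.92),
(1.98), (1.101) for every admissible sequence of domains, [4] Thms 3.1–3.2 being insensitive to the shape of the top member beyond (1.4)); nothing consumes it silently.
HONEST SCOPE ∕ NOT CLAIMED.  A named published estimate on the dented member; nothing of [4]∕[6]∕[15] asserted as a theorem; count-neutral; N05 ∕ N07 NOT discharged; one
finite `T⁴` programme at fixed `ε`, Bałaban as printed; nothing continuum ∕ ℝ⁴ ∕ OS ∕ mass-gap ∕ Clay.  No `sorry`, no `instance`, no `notation`; one `def` (a `Prop`).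
Unit `pub-ymgap-dag-n05-e` (g31), 2026-08-28.

RELATED IN THE TREE, NOT DUPLICATED (`rg` 2026-08-28T20:40Z: `ls Balaban1983to89 | grep -ci 'Real123Dented'` = 0): `B8Thm32GBoundCubeMemberHolds.prop6_real123_printed`
(dag-n05-c; the PURE theorem — the model, USED by the crown below the top), `B8Thm32GBoundCubeMember.prop6_real123_printed_of_GBound` ∕ `B8Prop6CubeMemberRealOfGBound`
(the pure reduction to REAL-1 + 𝒢-bound), `B8Thm32GBoundDentedCubeMember.GBoundDentedCubeMemberPrinted` (p661669; the dented 𝒢-bound, sibling), `Node00.CubeB8D ∕ .sq ∕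
.lamS` (p655171; USED), `B8Eq1101CubeMemberWeights.wPrinted` (dag-n05-c; print's weights, USED).
-/
noncomputable section

namespace Literature.MathematicalPhysics.QuantumFieldTheory.Balaban1983to89.B8Real123DentedCubeMember

open scoped Matrix
open B7Prop1Explicit (e)
open B8Eq140Level (SideTouches)
open B8LambdaSpaceKLevel (wt)
open B8Eq1101CubeMemberWeights (wPrinted)
open Node00 (CubeB8D)
open Literature.MathematicalPhysics.QuantumLattice (blockMap)

open Classical in
/-- **[Balaban1985RegularSpaces] (1.91)–(1.92), (1.101), (1.98) AT `U = 1` ON THE DENTED CUBE MEMBER `{Ω′_j}` OF [Balaban1985Variational] (148)–(150), TOP TRUNCATION — THE THREE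
REAL INEQUALITY FAMILIES OF THE FLAT p6 CONSUMER, IN ITS NORMALISATION** ([4] Theorems 3.1–3.2 for the operators «defined … for the sequence {Ω′_j} instead of {Ω_j}»,
[15] p. 301).  For the explicit matrices of the flat consumer at the printed weights `wPrinted` (`L = ℓ + 1`, dimension `d + 1`) built on the DENTED data — sites
`S = Ω′₀ = □₀ = c.sq 0`, cells `B = {(j, y) : j ≤ k, y ∈ Λ′_j}` (`c.lamS`), `K` the flat site operator `Δ^η + Σ_j a_j(L^jη)^{−2}Q_j*Q_j` weighted on the dented cells, `T`,
`Q` as displayed: there are constants `B_G > 0`, `B′₀ᴴ > 0`, `B′₂, B_R ≥ 0` and thresholds `ρ₀, M₀, N₀` such that for every `η > 0`, `M_h ≥ 3` with `M₀ ≤ L·M_h`, every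
dented cube datum `c : CubeB8D (d+1) (ℓ+1) K Ω` on print's big-block sub-lattice (`M_hL ∣ c.ρ`, `M_hL ∣ c.M`, `R·M_hL ≤ c.ρ`, `2L ≤ R`, `N₀ + 1 ≤ R·L·M_h`, `ρ₀ ≤ c.ρ`)
whose ambient top member `Ω_k` is a union of cubes of side `M_hL^{k+1}` of the grid anchored at `□_k`'s fine lower corner `Lᵏ(c.a − c.ρ)` ((1.4)₂):
REAL-1 ((1.91)–(1.92): `T⁻¹ρ′` and its gradient, weighted by `(Lʲη)²` on `Ω′_j`, `≤ B_G·r`), REAL-2 ((1.101): `T⁻¹T⁻¹Qᵀ(QT⁻²Qᵀ)⁻¹X`, its gradient `≤ B′₀ᴴ·s` and its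
Laplacian `≤ B′₂·s`), REAL-3 ((1.98): `(1 − T⁻¹Qᵀ(QT⁻²Qᵀ)⁻¹QT⁻¹)ρ′ ≤ B_R·r`), all over the dented tower `{c.sq j}_{j ≤ k}`.  The body of dag-n05-c's THEOREM
`B8Thm32GBoundCubeMemberHolds.prop6_real123_printed d ℓ` at `n = k` with `cubeFam false … j ↦ c.sq j`, `cubeLamS … k ↦ c.lamS`, plus the anchored dent premise of
`GBoundDentedCubeMemberPrinted`.  OPEN in the tree (the truncations `n < k` of a dented member are the pure member's and are served by the pure theorem).
[cite: Balaban1985RegularSpaces, (1.91)–(1.92) p.91, (1.98) p.92, (1.101) p.93, p.98, (1.4) p.77; Balaban1985BackgroundPropagators, Theorem 3.1 (3.47) p.398, Theorem 3.2 (3.48) p.398; Balaban1985Variational, (148)–(151) p.301, p.300; Balaban1984PropagatorsII, Prop. 2.3 (2.87) p.238] -/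
def Real123DentedCubeMemberPrinted (d ℓ : ℕ) : Prop :=
  ∃ BG B₀'H B₂' BR ρ₀ M₀ : ℝ, ∃ N₀ : ℕ, 0 < BG ∧ 0 < B₀'H ∧ 0 ≤ B₂' ∧ 0 ≤ BR ∧
    ∀ (η : ℝ), 0 < η → ∀ (Mh : ℕ), 3 ≤ Mh → M₀ ≤ ((ℓ : ℝ) + 1) * Mh →
    ∀ (K' : ℕ) (Ω : ℕ → Set (Fin (d + 1) → ℤ)) (c : CubeB8D (d + 1) (ℓ + 1) K' Ω) (R : ℕ),
      Mh * (ℓ + 1) ∣ c.ρ → Mh * (ℓ + 1) ∣ c.M → R * (Mh * (ℓ + 1)) ≤ c.ρ → 2 * (ℓ + 1) ≤ R → N₀ + 1 ≤ R * ((ℓ + 1) * Mh) → ρ₀ ≤ (c.ρ : ℝ) →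
      (∀ x y : Fin (d + 1) → ℤ,
          blockMap (Mh * (ℓ + 1) ^ (c.k + 1)) (x - fun i => (((ℓ + 1 : ℕ) : ℤ)) ^ c.k * (c.a i - c.ρ)) =
            blockMap (Mh * (ℓ + 1) ^ (c.k + 1)) (y - fun i => (((ℓ + 1 : ℕ) : ℤ)) ^ c.k * (c.a i - c.ρ)) → x ∈ Ω c.k → y ∈ Ω c.k) →
    ∀ (S : Finset (Fin (d + 1) → ℤ)), (∀ z, z ∈ S ↔ z ∈ c.sq 0) →
    ∀ (B : Finset (ℕ × (Fin (d + 1) → ℤ))), (∀ p, p ∈ B ↔ p.1 ≤ c.k ∧ p.2 ∈ c.lamS p.1) →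
    ∀ (K : (Fin (d + 1) → ℤ) → (Fin (d + 1) → ℤ) → ℝ), (∀ x z, K x z =
        ((η ^ 2)⁻¹ * ∑ μ : Fin (d + 1), ((2 : ℝ) * (if z = x then (1 : ℝ) else 0) - (if z = x + e μ then (1 : ℝ) else 0)
          - (if z = x - e μ then (1 : ℝ) else 0))) +
        (∑ j ∈ Finset.range (c.k + 1), (if blockMap ((ℓ + 1) ^ j) x ∈ c.lamS j ∧
            blockMap ((ℓ + 1) ^ j) z = blockMap ((ℓ + 1) ^ j) x then
          wPrinted d ℓ η j * (((((ℓ + 1 : ℕ) : ℝ) ^ (d + 1))⁻¹) ^ j) ^ 2 else 0))) →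
    ∀ (T : Matrix ↥S ↥S ℝ), T = Matrix.of (fun x z : ↥S => K x.1 z.1) →
    ∀ (Q : Matrix ↥B ↥S ℝ), Q = Matrix.of (fun (p : ↥B) (z : ↥S) =>
        if blockMap ((ℓ + 1) ^ p.1.1) z.1 = p.1.2 then (((((ℓ + 1 : ℕ) : ℝ)) ^ (d + 1))⁻¹) ^ p.1.1 else 0) →
    -- REAL-1: (1.91)–(1.92) for `T⁻¹`
    (∀ (ρ' : ↥S → ℝ) (r : ℝ), 0 ≤ r →
      (∀ j, j ≤ c.k → ∀ z : ↥S, z.1 ∈ c.sq j → wt (ℓ + 1) η j ^ 2 * |ρ' z| ≤ r) →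
      ∀ φ : (Fin (d + 1) → ℤ) → ℝ, (∀ x, x ∉ c.sq 0 → φ x = 0) →
        (∀ v : ↥S, φ v.1 = ∑ z : ↥S, T⁻¹ v z * ρ' z) →
        (∀ x, |φ x| ≤ BG * r) ∧
        ∀ j, j ≤ c.k → ∀ p ∈ {b : (Fin (d + 1) → ℤ) × Fin (d + 1) | SideTouches (c.sq j) b.1 b.2},
          wt (ℓ + 1) η j * |η⁻¹ * (φ (p.1 + e p.2) - φ p.1)| ≤ BG * r) ∧
    -- REAL-2: (1.101) for `T⁻¹T⁻¹Qᵀ(QT⁻²Qᵀ)⁻¹`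
    (∀ (X : ↥B → ℝ) (s : ℝ), 0 ≤ s → (∀ p', |X p'| ≤ s) →
      ∀ φ : (Fin (d + 1) → ℤ) → ℝ, (∀ x, x ∉ c.sq 0 → φ x = 0) →
        (∀ v : ↥S, φ v.1 = ∑ p' : ↥B, (T⁻¹ * (T⁻¹ * Qᵀ) * (Q * T⁻¹ * T⁻¹ * Qᵀ)⁻¹) v p' * X p') →
        (∀ x, |φ x| ≤ B₀'H * s) ∧
        (∀ j, j ≤ c.k → ∀ p ∈ {b : (Fin (d + 1) → ℤ) × Fin (d + 1) | SideTouches (c.sq j) b.1 b.2},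
          wt (ℓ + 1) η j * |η⁻¹ * (φ (p.1 + e p.2) - φ p.1)| ≤ B₀'H * s) ∧
        (∀ j, j ≤ c.k → ∀ x ∈ c.sq j,
          wt (ℓ + 1) η j ^ 2 * |∑ μ : Fin (d + 1), (η ^ 2)⁻¹ * (2 * φ x - φ (x + e μ) - φ (x - e μ))| ≤ B₂' * s)) ∧
    -- REAL-3: (1.98) for `1 − T⁻¹Qᵀ(QT⁻²Qᵀ)⁻¹QT⁻¹`
    (∀ (ρ' : ↥S → ℝ) (r : ℝ), 0 ≤ r →
      (∀ j, j ≤ c.k → ∀ z : ↥S, z.1 ∈ c.sq j → wt (ℓ + 1) η j ^ 2 * |ρ' z| ≤ r) →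
      ∀ j, j ≤ c.k → ∀ v : ↥S, v.1 ∈ c.sq j →
        wt (ℓ + 1) η j ^ 2 * |ρ' v - ∑ z : ↥S, (T⁻¹ * (Qᵀ * ((Q * T⁻¹ * T⁻¹ * Qᵀ)⁻¹ * (Q * T⁻¹)))) v z * ρ' z| ≤ BR * r)

end Literature.MathematicalPhysics.QuantumFieldTheory.Balaban1983to89.B8Real123DentedCubeMember

end
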